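import Literature.Computability.AlgebraicComplexity.BI17InvariantsRectangularHighestWeight
import HarnessLib

/-!
# Invariants of odd rectangular weight vanish on forms that are even in one variable
# (the involution half of "ternary cubics have no invariants of odd degree")

Topic `Literature/Computability/AlgebraicComplexity`; theorems only (no definitions, no named
facts). Towards the last open clause of BI 2017 Ex. 3.7 (`BI2017_ex_3_7`, reduced in
`BI17Example37Proofs.lean` to: `O(Sym³ℂ³)^{SL_3}` has no odd degrees — Aronhold, the invariant
ring of ternary cubics is `ℂ[S,T]`, `deg S = 4`, `deg T = 6`): the classical involution argument.

* `aeval_formCoeff_eq_zero_of_mem_highestWeightSpace_const_odd`: a highest-weight vector `F` of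
  CONSTANT weight `(-s, …, -s)` with `s` ODD in `ℂ[Sym^D ℂ^{m+1}]` vanishes at every form `q` all of
  whose monomials have even degree in the first variable: `F` is a `det^{-s}`-semi-invariant of
  `GL` (`apply_eq_det_zpow_smul_of_mem_highestWeightSpace_const`, this seat), the reflection
  `g₀ = diag(-1, 1, …, 1)` has `det g₀ = -1` and fixes `q`, so `F(q) = (-1)^s F(q) = -F(q)`.
* `aeval_formCoeff_linSubst_eq_zero_of_odd`: hence an `SL_3`-invariant `F` of odd degree `d` on
  ternary cubics (`F ∈ O(Sym³ℂ³)^{SL_3}_d`, weight `(-d,-d,-d)`) vanishes on the `SL_3`-saturation of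
  the `6`-dimensional space `L` of cubics even in `x₀`. What remains for Ex. 3.7 is the DOMINANCE of
  `SL_3 × L → Sym³ℂ³` (a Jacobian certificate; sized in `HOME/bip/NOTE-p4g4-E33-odd-vanishing.md` of
  the cell), which would give `F = 0`.

HONEST FRAMING (cell `val-lit`, rung V3, row BI17): classical invariant theory as typed-fact
bookkeeping; nothing here bears on permanent versus determinant; VP ≠ VNP is NOT proved.

## References
* [BurgisserIkenmeyer2017] P. Bürgisser, C. Ikenmeyer, J. Algebra 477 (2017), Ex. 3.7 (L823),
  Rem. 3.13.
* [FultonHarrisGTM129] W. Fulton, J. Harris, GTM 129, §15.5.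

## Tree
`apply_eq_det_zpow_smul_of_mem_highestWeightSpace_const` (`RectangularHighestWeightSemiInvariant`);
`slInvariantsOfDegree_le_highestWeightSpace` (`BI17OddPlethysmColumnSets`); `isRationalRep_coordRep`
(`CoordRepRational`); `coordRep_apply`, `aeval_formCoeff_coordSubst`, `linSubstRep_apply`
(`OrbitCoordinateRing`, `LinSubst`); `linSubst_diagonal_monomial` (`OrbitClosureWeights`).

Provenance: val-lit cell, prover val-lit-p4 g4 (registry claim #1 on `BI2017_ex_3_7`).
-/

namespace Literature.Computability.AlgebraicComplexity

open MvPolynomial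
open _root_.Literature.NumberTheory.DiophantineGeometry

section Involution

variable {m D : ℕ}

/-- The reflection `g₀ = diag(-1, 1, …, 1)` of `GL_{m+1}(ℂ)`. [folklore] -/
private theorem exists_reflectionGL :
    ∃ g : GL (Fin (m + 1)) ℂ,
      (g : Matrix (Fin (m + 1)) (Fin (m + 1)) ℂ) =
          Matrix.diagonal (fun i : Fin (m + 1) => if i = 0 then (-1 : ℂ) else 1) ∧
        (g : Matrix (Fin (m + 1)) (Fin (m + 1)) ℂ).det = -1 ∧ g⁻¹ = g := by
  set c : Fin (m + 1) → ℂ := fun i => if i = 0 then (-1 : ℂ) else 1 with hc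
  have hcc : ∀ i, c i * c i = 1 := fun i => by
    simp only [hc]
    split_ifs <;> norm_num
  have hdet : (Matrix.diagonal c).det = -1 := by
    rw [Matrix.det_diagonal, Fin.prod_univ_succ]
    have h1 : ∀ i : Fin m, c i.succ = 1 := fun i => by simp [hc, Fin.succ_ne_zero]
    simp only [h1, Finset.prod_const_one, mul_one]
    simp [hc]
  have hdet0 : (Matrix.diagonal c).det ≠ 0 := by rw [hdet]; norm_num
  refine ⟨Matrix.GeneralLinearGroup.mkOfDetNeZero _ hdet0, Matrix.GeneralLinearGroup.val_mkOfDetNeZero _ _,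
    by rw [Matrix.GeneralLinearGroup.val_mkOfDetNeZero]; exact hdet, ?_⟩
  -- `g₀ g₀ = 1`
  have hsq : Matrix.GeneralLinearGroup.mkOfDetNeZero _ hdet0 * Matrix.GeneralLinearGroup.mkOfDetNeZero _ hdet0 = 1 := by
    refine Units.ext ?_
    rw [Units.val_mul, Matrix.GeneralLinearGroup.val_mkOfDetNeZero, Units.val_one,
      Matrix.diagonal_mul_diagonal]
    have : (fun i => c i * c i) = fun _ => (1 : ℂ) := funext hcc
    rw [this, Matrix.diagonal_one]
  exact inv_eq_of_mul_eq_one_right hsq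

/-- The reflection `x₀ ↦ -x₀` fixes every form all of whose monomials have even degree in `x₀`.
[folklore] -/
private theorem linSubst_reflection_eq_self {q : MvPolynomial (Fin (m + 1)) ℂ}
    (hq : ∀ e ∈ q.support, Even (e 0)) :
    linSubst (Fin (m + 1)) ℂ (Matrix.diagonal (fun i : Fin (m + 1) => if i = 0 then (-1 : ℂ) else 1)) q = q := by
  classical
  conv_lhs => rw [q.as_sum]
  conv_rhs => rw [q.as_sum]
  rw [map_sum]
  refine Finset.sum_congr rfl fun e he => ?_
  rw [linSubst_diagonal_monomial]
  have hprod : (e.prod fun i n => (if i = 0 then (-1 : ℂ) else 1) ^ n) = 1 := by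
    rw [Finsupp.prod]
    refine Finset.prod_eq_one fun i _ => ?_
    split_ifs with hi
    · subst hi
      exact (hq e he).neg_one_pow
    · exact one_pow _
  rw [hprod, one_smul]

/-- **A highest-weight vector of odd constant weight vanishes on forms even in `x₀`.** For `F` in the
highest-weight space of the constant weight `(-s, …, -s)`, `s` odd, of `ℂ[Sym^D ℂ^{m+1}]` and a
polynomial `q` all of whose monomials have even degree in the first variable, `F(q) = 0`: `F` is a
`det^{-s}`-semi-invariant and the reflection `diag(-1,1,…,1)` (determinant `-1`) fixes `q`.
[cite: BurgisserIkenmeyer2017, Ex. 3.7] -/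
theorem aeval_formCoeff_eq_zero_of_mem_highestWeightSpace_const_odd {s : ℕ} (hs : Odd s)
    {F : MvPolynomial (DegIdx (Fin (m + 1)) D) ℂ}
    (hF : F ∈ highestWeightSpace (coordRep (Fin (m + 1)) ℂ D) (fun _ : Fin (m + 1) => -(s : ℤ)))
    {q : MvPolynomial (Fin (m + 1)) ℂ} (hq : ∀ e ∈ q.support, Even (e 0)) :
    aeval (formCoeff D q) F = 0 := by
  haveI : Infinite ℂ := CharZero.infinite ℂ
  obtain ⟨g, hg, hdet, hinv⟩ := exists_reflectionGL (m := m)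
  have hsemi := apply_eq_det_zpow_smul_of_mem_highestWeightSpace_const (isRationalRep_coordRep D) hF g
  rw [hdet] at hsemi
  have hpow : ((-1 : ℂ) ^ (-(s : ℤ))) = -1 := by
    rw [zpow_neg, zpow_natCast, hs.neg_one_pow, inv_neg, inv_one]
  rw [hpow, neg_one_smul] at hsemi
  -- evaluate at `q`: `F(g⁻¹ q) = F(q)` since `g⁻¹ = g` fixes `q`
  have heval : aeval (formCoeff D q) (coordRep (Fin (m + 1)) ℂ D g F) = aeval (formCoeff D q) F := by
    rw [coordRep_apply, aeval_formCoeff_coordSubst, hinv, linSubstRep_apply, hg,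
      linSubst_reflection_eq_self hq]
  rw [hsemi, map_neg] at heval
  -- `-x = x` in characteristic `0`
  have h2 : (2 : ℂ) * aeval (formCoeff D q) F = 0 := by linear_combination -heval
  exact (mul_eq_zero.mp h2).resolve_left two_ne_zero

end Involution

/-! ### Ternary cubics: odd-degree invariants vanish on the `SL_3`-saturation of the `x₀`-even cubics -/

section TernaryCubics

/-- **An `SL_3`-invariant of odd degree `d` on ternary cubics vanishes at `g · q` for every `g ∈ SL_3`
and every cubic `q` even in `x₀`** (its weight is `(-d,-d,-d)`; the involution lemma above, and
`SL_3`-invariance `F(g · q) = F(q)`). The remaining step towards "no odd-degree invariants of ternary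
cubics" (BI 2017 Ex. 3.7, `E(3,3) = 2(ℕ ∖ {1})`) is the Zariski density of these `g · q`.
[cite: BurgisserIkenmeyer2017, Ex. 3.7] -/
theorem aeval_formCoeff_linSubst_eq_zero_of_odd {d : ℕ} (hd : Odd d)
    {F : MvPolynomial (DegIdx (Fin 3) 3) ℂ} (hF : F ∈ slInvariantsOfDegree (Fin 3) ℂ 3 d)
    (g : Matrix.SpecialLinearGroup (Fin 3) ℂ) {q : MvPolynomial (Fin 3) ℂ}
    (hq : ∀ e ∈ q.support, Even (e 0)) :
    aeval (formCoeff 3 (linSubst (Fin 3) ℂ (g : Matrix (Fin 3) (Fin 3) ℂ) q)) F = 0 := by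
  -- the weight of `F` is `(-d,-d,-d)`
  have hHW : F ∈ highestWeightSpace (coordRep (Fin 3) ℂ 3) (fun _ : Fin 3 => -(d : ℤ)) := by
    have h := slInvariantsOfDegree_le_highestWeightSpace (m := 3) (D := 3) (d := d) (by norm_num)
      ⟨d, by ring⟩ hF
    rwa [show (3 * d / 3 : ℕ) = d from Nat.mul_div_cancel_left d (by norm_num)] at h
  -- `SL_3`-invariance: `F(g · q) = F(q)` (apply the invariance under `g⁻¹`)
  have hinv := ((mem_slInvariantsOfDegree_iff 3 d F).mp hF).2 g⁻¹
  have heval : aeval (formCoeff 3 (linSubst (Fin 3) ℂ (g : Matrix (Fin 3) (Fin 3) ℂ) q)) F =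
      aeval (formCoeff 3 q) F := by
    have h := congrArg (aeval (formCoeff 3 q)) hinv
    rw [coordRep_apply, aeval_formCoeff_coordSubst, ← map_inv, inv_inv, linSubstRep_apply,
      Matrix.SpecialLinearGroup.coe_GL_coe_matrix] at h
    exact h
  rw [heval]
  exact aeval_formCoeff_eq_zero_of_mem_highestWeightSpace_const_odd (m := 2) hd hHW hq

end TernaryCubics

end Literature.Computability.AlgebraicComplexity
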